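import Literature.Computability.Cryptography.ShorModExpBlock
import Literature.Computability.QuantumComplexity.RevUncomputeUniform
import HarnessLib

/-!
# Kitaev's order-finding family is polynomial-time uniform (`kitaevModExpFamily_isUniform` discharged)

Family `PQC`; discharges the programming fact `ModExpBlock.kitaevModExpFamily_isUniform` of
`ShorModExpBlock.lean` — the family `kitaevFamily mW VB` (Hadamard tests around the clean
modular-exponentiation block `VB`, `KitaevPhaseEstimationCircuit.kitaevCircuit`) is polynomial-time
uniform (Shor 1997, §2, p. 7: "the design of the gate array be produced by a polynomial-time
(classical) computation"; Kitaev 1995, §4, p. 15: "our procedure is uniform") — and with it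
`Kitaev1995_orderFindingFamily` (`Kitaev1995_orderFindingFamily_holds`).

The description `1^ℓ ↦ sigmaEncode ⟨ℓ, numControls ℓ + mW ℓ, kitaevCircuit (VB ℓ) (typeOf ℓ)⟩` is
the concatenation of three polynomial-time pieces, each rendered from a generator program
(`GenPrograms.lean`, `TokenStreams.lean`, the gadgets of `RevTableauUniform.lean` and
`RevUncomputeUniform.lean`): (1) the header, the Hadamard layer, the suffix `NOT`s, the forward
tableau and the read-out of the clean block (`GStmt.render_out_mem_FP`); (2) the tableau run
backwards, generated as a reversed token stream and rendered after reversal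
(`render_reverse_out_mem_FP`, `RevClean.reverse_out_compGR`); (3) the suffix `NOT`s again, the
phase layer `S³` on the sine-test controls, and the Hadamard layer (`append_mem_FP`). The proof is
the stream identity `desc_eq`.

## References

* P. W. Shor, SIAM J. Comput. 26 (1997) 1484–1509, §2 (p. 7 of arXiv:quant-ph/9508027v2) and §3.
* A. Yu. Kitaev, arXiv:quant-ph/9511026 (1995), §4 (p. 15).
* S. Arora, B. Barak, *Computational Complexity: A Modern Approach*, CUP 2009, §6.2 (Def. 6.12,
  Remark 6.7, proof of Thm. 6.15).
-/

noncomputable section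

namespace Literature.Computability.Cryptography

namespace ModExpBlock

open _root_.Computability Complexity QuantumComplexity QuantumComplexity.RevClean QuantumComplexity.RevSim
  QuantumComplexity.RevDesc Kitaev1995 OFPostCF

attribute [local simp] GExpr.eval

/-! ### The quantities of the layout as counter expressions in the family index `uu` -/

/-- `L = 2ℓ + 1` levels. [folklore] -/
def LvE : GE := .add (.mul (.const 2) (.var .uu)) (.const 1)
/-- `B = 6144 L` repetitions. [folklore] -/
def BE : GE := .mul (.const 6144) LvE
/-- `K = 4 · (L · 2B)` controls. [folklore] -/
def KE : GE := .mul (.const 4) (.mul LvE (.mul (.const 2) BE))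
/-- `dataN = ℓ + K` data wires. [folklore] -/
def dataNE : GE := .add (.var .uu) KE
/-- the tableau input length `tabN = dataN + (ℓ + 1)` [folklore] -/
def NE : GE := .add dataNE (.add (.var .uu) (.const 1))
/-- the ancilla count `numControls + mW = K + (ℓ + 1) + ancN (tabN) + JJ (tabN) · A₁` [folklore] -/
def ancE : GE := .add (.add KE (.add (.var .uu) (.const 1)))
  (.add ((ancNE MB.tm eB).subst (substN NE)) (.mul ((JJE eB MB).subst (substN NE)) (.const (A₁ MB))))

variable (env : GV → ℕ)

/-- value of `LvE` [folklore] -/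
@[simp] theorem eval_LvE : LvE.eval env = numLevels (env .uu) := by simp [LvE, numLevels]
/-- value of `BE` [folklore] -/
@[simp] theorem eval_BE : BE.eval env = blockSize (env .uu) := by simp [BE, blockSize]
/-- value of `KE` [folklore] -/
@[simp] theorem eval_KE : KE.eval env = numControls (env .uu) := by simp [KE, numControls, numTrials]
/-- value of `dataNE` [folklore] -/
@[simp] theorem eval_dataNE : dataNE.eval env = dataN (env .uu) := by simp [dataNE, dataN]
/-- value of `NE` [folklore] -/
@[simp] theorem eval_NE : NE.eval env = tabN (env .uu) := by simp [NE, tabN, sufV, dataN]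

/-- The work-wire count in closed form. [folklore] -/
theorem mW_eq (ℓ : ℕ) : mW ℓ = (ℓ + 1) + ancN MB.tm eB (tabN ℓ) + JJ eB MB (tabN ℓ) * A₁ MB := by
  have h : totN ℓ = tabN ℓ + ancN MB.tm eB (tabN ℓ) + JJ eB MB (tabN ℓ) * A₁ MB := rfl
  rw [mW, h, tabN]
  simp [sufV]
  omega

/-- value of `ancE`: the ancilla count of Kitaev's family [folklore] -/
@[simp] theorem eval_ancE : ancE.eval env = numControls (env .uu) + mW (env .uu) := by
  rw [mW_eq]
  simp [ancE, GExpr.eval_subst, eval_substN]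
  ring

/-- `NE` mentions the family index only. [folklore] -/
theorem inUU_NE : InUU NE := by
  intro x hx
  simp [NE, dataNE, KE, LvE, BE, GExpr.fv] at hx
  exact hx

/-! ### The generators of the Kitaev-specific layers -/

/-- **the header** `dbl (bin ℓ) 01 1^{2 anc} 01` [folklore] -/
def headerKG : GS :=
  .seq (ticksG (.var .uu)) (.seq (.emit (Tok.dump false true :: litT [false, true]))
    (.seq (.loop .jj (.mul (.const 2) ancE) (.emit [Tok.lit true])) (.emit (litT [false, true]))))

/-- **the Hadamard layer**: one `H` on each control wire `ℓ + j`, `j < K` [cite: Kitaev1995, §3 (the measuring circuit: Hadamard tests)] -/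
def hLayerKG : GS := .loop .jj KE (agateG ⟨.H, [.add (.var .uu) (.var .jj)]⟩)

/-- the suffix `NOT`s: wires `dataN + 1 + i`, `i < ℓ` (the suffix is `0 1^ℓ`) [folklore] -/
def nots1G : GS := notsSegG [(.add dataNE (.const 1), .var .uu)]

/-- the wire of the sine-test control `(t, l, i)`: `ℓ + t (L 2B) + (l 2B + (B + i))` [folklore] -/
def sWireE : GE := .add (.var .uu) (.add (.mul (.var .tt) (.mul LvE (.mul (.const 2) BE)))
  (.add (.mul (.var .jj) (.mul (.const 2) BE)) (.add BE (.var .xn))))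

/-- **the phase layer**: `S³` on every sine-test control wire, trial by trial, level by level
[cite: Kitaev1995, §3 Remark 8 (the phase shift for the sine test)] -/
def phaseKG : GS :=
  .loop .tt (.const 4) (.loop .jj LvE (.loop .xn BE
    (seqs [agateG ⟨.S, [sWireE]⟩, agateG ⟨.S, [sWireE]⟩, agateG ⟨.S, [sWireE]⟩])))

/-! ### Their streams -/

/-- The header stream. [folklore] -/
theorem out_headerKG : headerKG.out env = headerToks (env .uu) (numControls (env .uu) + mW (env .uu)) := by
  simp [headerKG, GStmt.out, headerToks, flatMap_range_const]

/-- The abstract `H` gate on wire `w` (a description record, not the matrix `Cryptography.hGate`). [folklore] -/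
def agH (w : ℕ) : AGate ℕ := ⟨.H, [w]⟩
/-- The abstract `S` gate on wire `w` (a description record, not the matrix `Cryptography.sGate`). [folklore] -/
def agS (w : ℕ) : AGate ℕ := ⟨.S, [w]⟩

/-- The Hadamard-layer stream. [folklore] -/
theorem out_hLayerKG : hLayerKG.out env =
    ((List.range (numControls (env .uu))).map fun j => agH (env .uu + j)).flatMap AGate.toks := by
  simp [hLayerKG, GStmt.out, List.flatMap_map, agH, AGate.map]

/-- The suffix-`NOT` stream is the stream of `notsV dataN (0 1^ℓ)`. [folklore] -/
theorem out_nots1G : nots1G.out env = (notsV (dataN (env .uu)) (sufV (env .uu))).flatMap opToks := by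
  rw [nots1G, out_notsSegG _ (fun p hp => by simp at hp; subst hp; simp [dataNE, KE, LvE, BE, GExpr.fv])]
  rw [sufV, show false :: ones (env .uu) = [false] ++ List.replicate (env .uu) true from rfl, notsV_append,
    notsV_singleton_false, notsV_replicate_true]
  simp [Nat.add_assoc]

/-- The wire of the sine-test control `(t, l, i)` of a family of index `ℓ`. [folklore] -/
def sWire (ℓ t l i : ℕ) : ℕ := ℓ + (t * (numLevels ℓ * (2 * blockSize ℓ)) + (l * (2 * blockSize ℓ) + (blockSize ℓ + i)))

/-- The abstract phase layer: `S³` on every sine-test control, trial by trial, level by level. [folklore] -/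
def phaseGates (ℓ : ℕ) : List (AGate ℕ) :=
  (List.range 4).flatMap fun t => (List.range (numLevels ℓ)).flatMap fun l =>
    (List.range (blockSize ℓ)).flatMap fun i => [agS (sWire ℓ t l i), agS (sWire ℓ t l i), agS (sWire ℓ t l i)]

/-- The phase-layer stream. [folklore] -/
theorem out_phaseKG : phaseKG.out env = (phaseGates (env .uu)).flatMap AGate.toks := by
  simp [phaseKG, GStmt.out, sWireE, agS, AGate.map, List.flatMap_assoc, phaseGates, sWire]

/-! ### The three generators and their hygiene -/

/-- **Piece 1**: header, Hadamard layer, suffix `NOT`s, the tableau forwards, the read-out. [folklore] -/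
def gen1 : GS := seqs [headerKG, hLayerKG, nots1G, compGW eB MB opsG NE, outGW eB MB opsG NE]

/-- **Piece 2**: the tableau backwards, as a reversed token stream. [folklore] -/
def gen2 : GS := compGW eB MB opsGR NE

/-- **Piece 3**: suffix `NOT`s, the phase layer, the Hadamard layer. [folklore] -/
def gen3 : GS := seqs [nots1G, phaseKG, hLayerKG]

/-- The loop variables of piece 1 are `tt`, `jj`, `ii`. [folklore] -/
theorem lv_gen1 : ∀ i ∈ gen1.loopVars, i = GV.tt ∨ i = GV.jj ∨ i = GV.ii := by
  intro i hi
  simp only [gen1, loopVars_seqs, List.flatMap_cons, List.flatMap_nil, List.append_nil, List.mem_append] at hi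
  rcases hi with hi | hi | hi | hi | hi
  · simp [headerKG, GStmt.loopVars, ticksG] at hi
    rcases hi with rfl | rfl <;> simp
  · simp [hLayerKG, GStmt.loopVars, agateG, seqs, wireG, ticksG] at hi
    rcases hi with rfl | rfl <;> simp
  · exact loopVars_notsSegG_sub _ i hi
  · exact loopVars_compGW_sub loopVars_opsG_sub _ i hi
  · exact loopVars_outGW_sub loopVars_opsG_sub _ i hi

/-- The family index is not a loop variable of piece 1. [folklore] -/
theorem uu_not_mem_loopVars_gen1 : GV.uu ∉ gen1.loopVars := fun h => by
  rcases lv_gen1 _ h with h | h | h <;> exact absurd h (by decide)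

/-- The family index is not a loop variable of piece 2. [folklore] -/
theorem uu_not_mem_loopVars_gen2 : GV.uu ∉ gen2.loopVars := fun h => by
  rcases loopVars_compGW_sub loopVars_opsGR_sub _ _ h with h | h | h <;> exact absurd h (by decide)

/-- The family index is not a loop variable of piece 3. [folklore] -/
theorem uu_not_mem_loopVars_gen3 : GV.uu ∉ gen3.loopVars := fun h => by
  simp only [gen3, loopVars_seqs, List.flatMap_cons, List.flatMap_nil, List.append_nil, List.mem_append] at h
  rcases h with h | h | h
  · rcases loopVars_notsSegG_sub _ _ h with h | h | h <;> exact absurd h (by decide)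
  · simp [phaseKG, GStmt.loopVars, agateG, seqs, wireG, ticksG] at h
  · simp [hLayerKG, GStmt.loopVars, agateG, seqs, wireG, ticksG] at h

/-- Piece 1 reuses no loop variable. [folklore] -/
theorem noReuse_gen1 : gen1.noReuse = true :=
  noReuse_seqs _ fun s hs => by
    simp only [List.mem_cons, List.not_mem_nil, or_false] at hs
    rcases hs with rfl | rfl | rfl | rfl | rfl
    · rfl
    · rfl
    · exact noReuse_notsSegG _
    · exact noReuse_compGW loopVars_opsG_sub noReuse_opsG _
    · exact noReuse_outGW loopVars_opsG_sub noReuse_opsG _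

/-- Piece 2 reuses no loop variable. [folklore] -/
theorem noReuse_gen2 : gen2.noReuse = true := noReuse_compGW loopVars_opsGR_sub noReuse_opsGR _

/-- Piece 3 reuses no loop variable. [folklore] -/
theorem noReuse_gen3 : gen3.noReuse = true :=
  noReuse_seqs _ fun s hs => by
    simp only [List.mem_cons, List.not_mem_nil, or_false] at hs
    rcases hs with rfl | rfl | rfl
    · exact noReuse_notsSegG _
    · rfl
    · rfl

/-! ### The description and its pieces -/

/-- Piece 1 rendered. [folklore] -/
def piece1 (z : List Bool) : List Bool := Tok.render 0 (gen1.out (GenProg.initEnv .uu z.length))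
/-- Piece 2 rendered after reversal. [folklore] -/
def piece2 (z : List Bool) : List Bool := Tok.render 0 (gen2.out (GenProg.initEnv .uu z.length)).reverse
/-- Piece 3 rendered. [folklore] -/
def piece3 (z : List Bool) : List Bool := Tok.render 0 (gen3.out (GenProg.initEnv .uu z.length))

/-- **The description of Kitaev's family as a string function of `1^ℓ`.** [folklore] -/
def descK (z : List Bool) : List Bool := piece1 z ++ (piece2 z ++ piece3 z)

/-- **`descK ∈ FP`** (`GStmt.render_out_mem_FP`, `render_reverse_out_mem_FP`, `append_mem_FP`).
[cite: AroraBarak2009, §6.2 (Def. 6.12, proof of Thm. 6.15)] -/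
theorem descK_mem_FP : descK ∈ FP :=
  QuantumComplexity.append_mem_FP (GStmt.render_out_mem_FP gen1 .uu uu_not_mem_loopVars_gen1 noReuse_gen1)
    (QuantumComplexity.append_mem_FP (render_reverse_out_mem_FP gen2 .uu uu_not_mem_loopVars_gen2 noReuse_gen2)
      (GStmt.render_out_mem_FP gen3 .uu uu_not_mem_loopVars_gen3 noReuse_gen3))

/-! ### The layers of the circuit as bit streams -/

/-- Bits of the abstract `H` gate. [folklore] -/
@[simp] theorem bits_agH (w : ℕ) : (agH w).bits = gateBits 0 1 [w] := by simp [agH, AGate.bits, symCode, symArity]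
/-- Bits of the abstract `S` gate. [folklore] -/
@[simp] theorem bits_agS (w : ℕ) : (agS w).bits = gateBits 1 1 [w] := by simp [agS, AGate.bits, symCode, symArity]

/-- A `flatMap` of empty lists is empty. [folklore] -/
private theorem flatMap_nil' {α β : Type} (l : List α) : (l.flatMap fun _ => ([] : List β)) = [] := by
  induction l with
  | nil => rfl
  | cons a l ih => rw [List.flatMap_cons, ih]; rfl

/-- A `flatMap` over `finRange` of a function of the value is a `flatMap` over `range` (the same as
`BPPSim.finRange_flatMap_val` of `SimTokens.lean`, which is not imported here). [folklore] -/
private theorem finRange_flatMap_val' {α : Type} (P : ℕ) (f : ℕ → List α) :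
    ((List.finRange P).flatMap fun j : Fin P => f (j : ℕ)) = (List.range P).flatMap f := by
  rw [← List.map_coe_finRange_eq_range, List.flatMap_map]

/-- `flatMap` over a product range. [folklore] -/
theorem flatMap_range_mul {α : Type} (a b : ℕ) (f : ℕ → List α) :
    (List.range (a * b)).flatMap f = (List.range a).flatMap fun t => (List.range b).flatMap fun r => f (t * b + r) := by
  induction a with
  | zero => simp
  | succ a ih => rw [Nat.succ_mul, flatMap_range_add, ih, List.range_succ, List.flatMap_append, List.flatMap_singleton]

/-- **The Hadamard layer describes as the bits of the abstract `H` gates.** [folklore] -/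
theorem flatMap_gateEnc_hadamardLayer (n m : ℕ) :
    (QuantumComplexity.hadamardLayer n (numControls n) m).flatMap gateEnc =
      ((List.range (numControls n)).map fun j => agH (n + j)).flatMap AGate.bits := by
  rw [QuantumComplexity.hadamardLayer, coinWires, List.flatMap_map, List.flatMap_map, List.flatMap_map,
    ← finRange_flatMap_val' (numControls n) fun j => (agH (n + j)).bits]
  refine List.flatMap_congr fun j _ => ?_
  simp [gateEnc_hOn, val_coinWire]

/-- **The type of a control from its position**: control `t (L 2B) + l 2B + σ B + i` has type `σ`,
and lies below `K`. [folklore] -/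
theorem typeOf_eq (n : ℕ) {t l i : ℕ} (ht : t < 4) (hl : l < numLevels n) (hi : i < blockSize n) (σ : Bool) :
    ∃ hv : t * (numLevels n * (2 * blockSize n)) + (l * (2 * blockSize n) + (σ.toNat * blockSize n + i)) < numControls n,
      typeOf n ⟨_, hv⟩ = σ := by
  have ht' : t < numTrials := ht
  have hval := val_layout_symm (ℓ := n) ⟨t, ht'⟩ ⟨l, hl⟩ σ ⟨i, hi⟩
  refine ⟨hval ▸ ((layout n).symm (⟨t, ht'⟩, ⟨l, hl⟩, σ, ⟨i, hi⟩)).isLt, ?_⟩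
  have : (⟨_, hval ▸ ((layout n).symm (⟨t, ht'⟩, ⟨l, hl⟩, σ, ⟨i, hi⟩)).isLt⟩ : Fin (numControls n)) =
      (layout n).symm (⟨t, ht'⟩, ⟨l, hl⟩, σ, ⟨i, hi⟩) := Fin.ext hval.symm
  rw [this, typeOf, Equiv.apply_symm_apply]

/-- The phase layer as a function of the position of a control: `S³` on sine-test controls. [folklore] -/
def pF (n : ℕ) (v : ℕ) : List Bool :=
  if hv : v < numControls n then
    (if typeOf n ⟨v, hv⟩ then gateBits 1 1 [n + v] ++ (gateBits 1 1 [n + v] ++ gateBits 1 1 [n + v]) else [])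
  else []

/-- `pF` on a cosine-test control. [folklore] -/
theorem pF_cos (n : ℕ) {t l i : ℕ} (ht : t < 4) (hl : l < numLevels n) (hi : i < blockSize n) :
    pF n (t * (numLevels n * (2 * blockSize n)) + (l * (2 * blockSize n) + i)) = [] := by
  obtain ⟨hv, hσ⟩ := typeOf_eq n ht hl hi false
  simp only [Bool.toNat_false, zero_mul, zero_add] at hv hσ
  rw [pF, dif_pos hv, hσ]
  rfl

/-- `pF` on a sine-test control. [folklore] -/
theorem pF_sin (n : ℕ) {t l i : ℕ} (ht : t < 4) (hl : l < numLevels n) (hi : i < blockSize n) :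
    pF n (t * (numLevels n * (2 * blockSize n)) + (l * (2 * blockSize n) + (blockSize n + i))) =
      gateBits 1 1 [sWire n t l i] ++ (gateBits 1 1 [sWire n t l i] ++ gateBits 1 1 [sWire n t l i]) := by
  obtain ⟨hv, hσ⟩ := typeOf_eq n ht hl hi true
  simp only [Bool.toNat_true, one_mul] at hv hσ
  rw [pF, dif_pos hv, hσ, if_pos rfl, sWire]

/-- **The phase layer describes as the bits of the abstract `S` gates.** [cite: Kitaev1995, §3 Remark 8] -/
theorem flatMap_gateEnc_phaseLayer (n m : ℕ) :
    (phaseLayer n (numControls n) m (typeOf n)).flatMap gateEnc = (phaseGates n).flatMap AGate.bits := by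
  -- the layer over `range K` with a dependent test
  have h1 : (phaseLayer n (numControls n) m (typeOf n)).flatMap gateEnc = (List.range (numControls n)).flatMap (pF n) := by
    rw [phaseLayer, phaseLayerL, List.flatMap_assoc, ← finRange_flatMap_val' (numControls n) (pF n)]
    refine List.flatMap_congr fun j _ => ?_
    rw [pF, dif_pos j.isLt, Fin.eta]
    split_ifs <;> simp [gateEnc_sOn, val_coinWire]
  rw [h1, numControls, numTrials, flatMap_range_mul, phaseGates]
  simp only [List.flatMap_assoc]
  refine List.flatMap_congr fun t ht => ?_
  rw [List.mem_range] at ht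
  rw [flatMap_range_mul]
  refine List.flatMap_congr fun l hl => ?_
  rw [List.mem_range] at hl
  rw [two_mul, flatMap_range_add]
  rw [List.flatMap_congr (g := fun _ => []) fun r hr => ?_, flatMap_nil', List.nil_append]
  · refine List.flatMap_congr fun i hi => ?_
    rw [List.mem_range] at hi
    rw [← two_mul, show t * (numLevels n * (2 * blockSize n)) + (l * (2 * blockSize n) + (blockSize n + i)) =
      t * (numLevels n * (2 * blockSize n)) + (l * (2 * blockSize n) + (blockSize n + i)) from rfl, pF_sin n ht hl hi]
    simp
  · rw [List.mem_range] at hr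
    rw [← two_mul]
    exact pF_cos n ht hl hr

/-- **The block describes as the `opBits` of the clean program.** [folklore] -/
theorem flatMap_gateEnc_VB (n : ℕ) : (VB n).gates.flatMap gateEnc = (opsN n).flatMap opBits :=
  flatMap_gateEnc_revCompile_toRevList (layoutN_pos n) (opsN n) (opsN_lt n) (opsFinB_wf n)

/-- The Hadamard-layer bits. [folklore] -/
def hBits (n : ℕ) : List Bool := ((List.range (numControls n)).map fun j => agH (n + j)).flatMap AGate.bits

/-- **The description of the `ℓ`-th circuit of Kitaev's family**, block by block. [folklore] -/
theorem sigmaEncode_kitaevFamily (n : ℕ) :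
    QCircuit.sigmaEncode (G := cliffordT) ⟨n, (kitaevFamily mW VB).ancillas n, (kitaevFamily mW VB).circ n⟩ =
      SProg.dbl (encodeNat n) ++ [false, true] ++ (List.replicate (2 * (numControls n + mW n)) true ++ [false, true]) ++
        (hBits n ++ ((notsV (dataN n) (sufV n)).flatMap opBits ++ ((comp eB MB (tabN n)).flatMap opBits ++
          ((outOps eB MB (tabN n)).flatMap opBits ++ ((comp eB MB (tabN n)).reverse.flatMap opBits ++
            ((notsV (dataN n) (sufV n)).flatMap opBits ++ ((phaseGates n).flatMap AGate.bits ++ hBits n))))))) := by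
  change boolPair (encodeNat n) (boolPair (unaryEncodeNat (numControls n + mW n))
    (QCircuit.encode (kitaevCircuit (VB n) (typeOf n)))) = _
  rw [kitaevCircuit, encode_eq_flatMap, List.flatMap_append, List.flatMap_append, List.flatMap_append,
    flatMap_gateEnc_VB, flatMap_gateEnc_hadamardLayer, flatMap_gateEnc_phaseLayer, ← hBits, opsN, cleanOps,
    show dataN n + (sufV n).length = tabN n from rfl,
    RevDesc.boolPair_eq, RevDesc.boolPair_eq, RevDesc.unaryEncodeNat_eq_replicate, dbl_replicate]
  simp only [List.flatMap_append, List.append_assoc]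

/-- The input variable of the generators holds `n`. [folklore] -/
theorem initEnv_uu (n : ℕ) : GenProg.initEnv GV.uu n GV.uu = n := by simp [GenProg.initEnv]

/-- **The stream of piece 1.** [folklore] -/
theorem out_gen1 (n : ℕ) : gen1.out (GenProg.initEnv .uu n) =
    headerToks n (numControls n + mW n) ++ ((((List.range (numControls n)).map fun j => agH (n + j)).flatMap AGate.toks) ++
      ((notsV (dataN n) (sufV n)).flatMap opToks ++ ((comp eB MB (tabN n)).flatMap opToks ++
        ((outOps eB MB (tabN n)).flatMap opToks ++ [])))) := by
  simp only [gen1, out_seqs, List.flatMap_cons, List.flatMap_nil, out_headerKG, out_hLayerKG, out_nots1G,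
    out_compG inUU_NE, out_outGW opToks (fun ops env => out_opsG ops env) loopVars_opsG_sub inUU_NE, eval_NE, initEnv_uu]

/-- **The stream of piece 3.** [folklore] -/
theorem out_gen3 (n : ℕ) : gen3.out (GenProg.initEnv .uu n) =
    (notsV (dataN n) (sufV n)).flatMap opToks ++ ((phaseGates n).flatMap AGate.toks ++
      ((((List.range (numControls n)).map fun j => agH (n + j)).flatMap AGate.toks) ++ [])) := by
  simp only [gen3, out_seqs, List.flatMap_cons, List.flatMap_nil, out_nots1G, out_phaseKG, out_hLayerKG, initEnv_uu]

/-- **Piece 1 rendered.** [folklore] -/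
theorem piece1_eq (z : List Bool) : piece1 z =
    SProg.dbl (encodeNat z.length) ++ [false, true] ++ (List.replicate (2 * (numControls z.length + mW z.length)) true ++ [false, true]) ++
      (hBits z.length ++ ((notsV (dataN z.length) (sufV z.length)).flatMap opBits ++
        ((comp eB MB (tabN z.length)).flatMap opBits ++ (outOps eB MB (tabN z.length)).flatMap opBits))) := by
  rw [piece1, out_gen1, render_headerToks, render_flatMap_toks, render_flatMap_opToks, render_flatMap_opToks,
    render_flatMap_opToks, Tok.render_nil, List.append_nil, hBits]

/-- **Piece 2 rendered.** [folklore] -/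
theorem piece2_eq (z : List Bool) : piece2 z = (comp eB MB (tabN z.length)).reverse.flatMap opBits := by
  rw [piece2, gen2, reverse_out_compGR inUU_NE, eval_NE, initEnv_uu, ← List.append_nil ((comp eB MB (tabN z.length)).reverse.flatMap opToks),
    render_flatMap_opToks, Tok.render_nil, List.append_nil]

/-- **Piece 3 rendered.** [folklore] -/
theorem piece3_eq (z : List Bool) : piece3 z =
    (notsV (dataN z.length) (sufV z.length)).flatMap opBits ++ ((phaseGates z.length).flatMap AGate.bits ++ hBits z.length) := by
  rw [piece3, out_gen3, render_flatMap_opToks, render_flatMap_toks, render_flatMap_toks, Tok.render_nil, List.append_nil, hBits]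

/-- **The stream identity**: the three rendered pieces are the description of Kitaev's family. [cite: AroraBarak2009, §6.2 (proof of Thm. 6.15: descriptions printed with counters)] -/
theorem descK_eq (z : List Bool) :
    descK z = QCircuit.sigmaEncode (G := cliffordT) ⟨z.length, (kitaevFamily mW VB).ancillas z.length, (kitaevFamily mW VB).circ z.length⟩ := by
  rw [descK, piece1_eq, piece2_eq, piece3_eq, sigmaEncode_kitaevFamily]
  simp only [List.append_assoc]

/-! ### Uniformity -/

/-- **Discharge of the programming fact `kitaevModExpFamily_isUniform`**: Kitaev's family around the
modular-exponentiation block is polynomial-time uniform (`descK_mem_FP`, `descK_eq`,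
`QCircuitFamily.isUniform_of_mem_FP`). [cite: Shor1997, §2 p.7 (uniformity of the gate array); Kitaev1995, §4 p.15] -/
theorem kitaevModExpFamily_isUniform_holds : kitaevModExpFamily_isUniform := by
  refine QCircuitFamily.isUniform_of_mem_FP _ ?_
  have h := descK_mem_FP
  rw [show descK = fun z => QCircuit.sigmaEncode (G := cliffordT)
    ⟨z.length, (kitaevFamily mW VB).ancillas z.length, (kitaevFamily mW VB).circ z.length⟩ from funext descK_eq] at h
  exact h

/-- **Discharge of `Kitaev1995_orderFindingFamily`** (`ShorOrderFindingQuantum.lean`; one of the named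
facts of `ShorTheoremAssembly.FACT_mem_BQP_of_facts` and of `FACT_mem_BQP_of_facts'`): Kitaev's
order-finding family with its clean modular-exponentiation block exists and is polynomial-time
uniform (`Kitaev1995_orderFindingFamily_of`, `ShorModExpBlock.lean`, with the uniformity just proved).
[cite: Shor1997, §3 p.8 (reversible computation of poly-time F keeping x, erasing garbage) and §2 p.7 (uniformity); Kitaev1995, §2.2 Lemma 1] -/
theorem _root_.Literature.Computability.Cryptography.Kitaev1995_orderFindingFamily_holds : Kitaev1995_orderFindingFamily :=
  Kitaev1995_orderFindingFamily_of kitaevModExpFamily_isUniform_holds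

end ModExpBlock

end Literature.Computability.Cryptography

end
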